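import Literature.NumberTheory.ComplexMultiplication.CMTypeRankSharedCharacter
import Literature.NumberTheory.ComplexMultiplication.CMTypeRankStabilizerClosure
import Literature.NumberTheory.ComplexMultiplication.CMTypeRankOverSubtype
import HarnessLib

/-!
# PARALLEL SHADOWS: two slots of a family of CM types whose type vectors cast proportional, non-zero shadows on a
# common `G`-set are never additive (a pair form of Yanai's subfield theorem)

COR-CM (cell `pub-hodgecm2`, binder seat `b16` gen 49, count-neutral claim SHADOW, file F1 — the abstract `G`-set
level; theorems only, no definition, no named fact, no `sorry`).  NEW as stated, hence under `Summits/`.  HONEST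
FRAMING: a lemma about the Kubota–Dodson rank of families of CM types; `HC_CM` is neither used nor asserted.

SETTING (the tree's `Literature.NumberTheory.ComplexMultiplication.CMTypeRankFamilies` / `…SharedCharacter`): a group
`G` acting slot by slot on `⊔_i E_i` (Deligne's `Hom(∏_i K_i, ℂ)`), types `Φ_i ⊆ E_i`, the family type
`Σ = sigmaType Φ`, the `±1`-vectors `u_g(Φ_i) = antiVec (Φ i) g` of the translates, Shimura's antisymmetric spans
`U(Φ_i) = antiSpan G (Φ i)`, always `U(Σ) ≤ ⊕_i U(Φ_i)` and `rank = dim U + 1`; ADDITIVITY `U(Σ) = ⊕_i U(Φ_i)` is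
`Hg(∏_i A_i) = ∏_i Hg(A_i)`.  `CMTypeRankSharedCharacter` proves: two slots carrying weights that transform under the
SAME function `χ : G → ℚ` and pair non-trivially with their types are never additive (the imaginary-quadratic
obstruction).  This file replaces the one-dimensional `χ` by an arbitrary `G`-SET `Z`:

> **Theorem** (`Shadow.finrank_antiSpan_sigmaType_lt_of_parallel`).  Let `Z` be a `G`-set and `F_k : Z → E_{i_k} → ℚ`
> (`k = 0, 1`, `i₀ ≠ i₁`) INVARIANT KERNELS, `F_k (g z) (g x) = F_k z x`.  The SHADOW of `Φ_{i_k}` on `Z` through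
> `F_k` is the function `c_k(z) = Σ_x F_k z x · u_1(Φ_{i_k})(x)`.  If the two shadows are PARALLEL, `c₀ = q · c₁`
> (`q ∈ ℚ`), and `c₀ ≠ 0`, then `dim U(Σ) < Σ_i dim U(Φ_i)` — STRICTLY; hence `rank(Σ) + |I| < Σ_i rank(Φ_i) + 1`
> and `Σ` is DEGENERATE (`rank(Σ) < |⊔ E_i|/2 + 1`), whatever the other members.

PROOF.  For an invariant kernel, `Σ_x F z x · u_g(Φ)(x) = c(g z)` (`sum_mul_antiVec_eq_apply_smul`: substitute
`y = g x` in `u_g(x) = u_1(g x)`).  Hence for a fixed `z₀` with `c₀(z₀) ≠ 0` the linear form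
`λ(w) = Σ_x F₀ z₀ x · w(i₀, x) − q Σ_y F₁ z₀ y · w(i₁, y)` takes the value `c₀(g z₀) − q c₁(g z₀) = 0` on every
simultaneous translate `u_g(Σ)`, so it kills `U(Σ)`; but `λ(ext_{i₀} u_1(Φ_{i₀})) = c₀(z₀) ≠ 0` while
`ext_{i₀} u_1(Φ_{i₀}) ∈ ⊕_i ext_i U(Φ_i)` (the necessity half of the tree's `CMTypeRankEvaluationCriterion`, for the
permutation representation `ℚ^Z`, where the equivariant maps and their values are COUNTS).

THE CASE THAT MATTERS (§2, `Shadow.finrank_antiSpan_sigmaType_lt_of_parallel_fibreSum`): `Z` a common equivariant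
QUOTIENT of the two slots, `π_k : E_{i_k} → Z`, `π_k(g x) = g π_k(x)` (for CM fields: a number field `k` received by
`K_{i₀}` and by `K_{i₁}`, `Z = Hom(k, ℂ)`, `π_k` = restriction of embeddings), `F_k z x = [π_k x = z]`.  Then
`c_k(z) = Σ_{π_k x = z} u_1(Φ_{i_k})(x) = 2 · #(Φ_{i_k} ∩ π_k⁻¹ z) − #π_k⁻¹(z)` (`Shadow.fibreSum_antiVec_one_eq`) is the
SIGNATURE of `Φ_{i_k}` over the place `z` — Yanai's multiplicities.  Parallel non-zero signatures over a common
subfield force degeneracy of the pair.  Two instances: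

* `Z` with two points swapped by `ρ` (an imaginary quadratic field): every shadow is a multiple of `δ_z − δ_{z̄}`, so
  "parallel" only asks both signature defects to be non-zero — `CMTypeRankSharedCharacter` /
  `SharedImaginaryQuadraticDegenerate` recovered;
* §3 **Yanai for pairs** (`Shadow.typeRank_sigmaType_lt_of_multiplicities`): `Φ_{i₀}` lies over a CM type `S₁ ⊆ Z`
  with multiplicities `(a₀, b₀)` and `Φ_{i₁}` over THE SAME `S₁` with multiplicities `(a₁, b₁)` (Gordon 9.4.3: "`π(Σ_{σ∈S}
  σ) = a Σ_{σ∈S₁} σ + b Σ_{σ∈S₁} σ̄`"); if `a₀ ≠ b₀` and `a₁ ≠ b₁` the pair `(Φ_{i₀}, Φ_{i₁})` is degenerate — even when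
  both members are nondegenerate (Yanai's one-type theorem needs `a = b` or `S₁` degenerate).

Contrapositive against the tree's stabiliser-closure criterion (`CMTypeRankStabilizerClosure`): under parallel
non-zero shadows NO element of `⟨Stab Φ_{i₀} ∪ Stab Φ_{i₁}⟩` acts on a slot as `ρ` — for CM fields: the two reflex
fields do not meet in a totally real field (`Shadow.not_exists_smul_eq_rho_of_parallel`).

## References

* [Gordon1999HodgeAVSurvey] B. B. Gordon, *A survey of the Hodge conjecture for abelian varieties*, §3 Theorem (Imai,
  Murty) with proof (the character-group computation); 7.5–7.7 (Murty, Hazama); 9.4.3 (Yanai's theorem on degenerate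
  types over a subfield, quoting H. Yanai, *On degenerate CM-types*, J. Number Theory 49 (1994)).
* [Deligne1982HodgeCycles] P. Deligne, *Hodge cycles on abelian varieties*, LNM 900 (1982), I Ex. 3.7, §4.

Provenance: Literature home (family `hodge`, namespace `Literature.NumberTheory.ComplexMultiplication.Shadow`) of the Summits-side `CorCM/ParallelShadowsSlots` (cell `pub-hodgecm2`, COR-CM; all its imports are `Literature/` and Mathlib), which `Literature/` may not import; theorems only, no named fact, no definition. Nothing here bears on `HC_CM`. Lane `lit-hodgefound` (Layer A3: CM types, their Kubota ranks and Galois combinatorics), seat p20.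
-/

set_option autoImplicit false

noncomputable section

open scoped BigOperators

universe u v w

namespace Literature.NumberTheory.ComplexMultiplication.Shadow

open Literature.NumberTheory.ComplexMultiplication
open scoped Classical

variable {G : Type u} [Group G] {I : Type v} {E : I → Type v} [∀ i, MulAction G (E i)]

/-! ### §0 Invariant kernels: the pairing of a translate is the shadow at the translated point -/

section Pairing

variable {X : Type*} [MulAction G X] [Fintype X] {Z : Type*} [MulAction G Z]

/-- **Translates pair with an invariant kernel through the shadow**: if `F (g • z) (g • x) = F z x` then
`Σ_x F z x · u_g(Ψ)(x) = Σ_x F (g • z) x · u_1(Ψ)(x)` (substitute `y = g • x` in `u_g(x) = u_1(g x)`).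
[cite: Gordon1999HodgeAVSurvey, §3 Theorem (proof)] -/
theorem sum_mul_antiVec_eq_apply_smul (Ψ : Set X) (F : Z → X → ℚ)
    (hF : ∀ (g : G) (z : Z) (x : X), F (g • z) (g • x) = F z x) (g : G) (z : Z) :
    ∑ x, F z x * antiVec Ψ g x = ∑ x, F (g • z) x * antiVec Ψ (1 : G) x := by
  calc ∑ x, F z x * antiVec Ψ g x = ∑ x, F (g • z) (g • x) * antiVec Ψ (1 : G) (g • x) := by
        refine Finset.sum_congr rfl fun x _ => ?_
        rw [antiVec_eq_antiVec_one_smul Ψ g x, hF g z x]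
    _ = ∑ x, F (g • z) x * antiVec Ψ (1 : G) x :=
        Equiv.sum_comp (MulAction.toPerm g) (fun y => F (g • z) y * antiVec Ψ (1 : G) y)

omit [Fintype X] in
/-- The fibre-indicator kernel `[π x = z]` of an equivariant map `π : X → Z` is invariant. [cite: Gordon1999HodgeAVSurvey, §3 Theorem (proof), 7.5 and 9.4.3] -/
theorem fibreInd_smul {π : X → Z} (hπ : ∀ (g : G) (x : X), π (g • x) = g • π x) (g : G) (z : Z) (x : X) :
    (if π (g • x) = g • z then (1 : ℚ) else 0) = if π x = z then (1 : ℚ) else 0 := by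
  rw [hπ]
  by_cases h : π x = z
  · rw [if_pos h, if_pos (by rw [h])]
  · rw [if_neg h, if_neg (fun h' => h (smul_left_cancel g h'))]

/-- The pairing with the fibre indicator is the FIBRE SUM `Σ_{π x = z} u(x)`. [cite: Gordon1999HodgeAVSurvey, §3 Theorem (proof), 7.5 and 9.4.3] -/
theorem sum_fibreInd_mul_eq (π : X → Z) (z : Z) (u : X → ℚ) :
    ∑ x, (if π x = z then (1 : ℚ) else 0) * u x = ∑ x ∈ Finset.univ.filter (fun x : X => π x = z), u x := by
  rw [Finset.sum_filter]
  refine Finset.sum_congr rfl fun x _ => ?_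
  split_ifs <;> simp

omit [MulAction G Z] in
/-- **The fibre sum of `u_1(Φ)` is the signature**: `Σ_{π x = z} u_1(Φ)(x) = 2 · #{x ∈ Φ | π x = z} − #{x | π x = z}`
(`u_1(Φ) = ±1` on `Φ` / off `Φ`). [cite: Gordon1999HodgeAVSurvey, 9.4.3] -/
theorem fibreSum_antiVec_one_eq (π : X → Z) (Φ : Set X) (z : Z) :
    ∑ x ∈ Finset.univ.filter (fun x : X => π x = z), antiVec Φ (1 : G) x =
      2 * ((Finset.univ.filter fun x : X => π x = z ∧ x ∈ Φ).card : ℚ) -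
        ((Finset.univ.filter fun x : X => π x = z).card : ℚ) := by
  have h1 : ∀ x : X, antiVec Φ (1 : G) x = 2 * (if x ∈ Φ then (1 : ℚ) else 0) - 1 := fun x => by
    by_cases hx : x ∈ Φ
    · rw [if_pos hx, antiVec, translateInd_of_mem (by rwa [one_smul])]
    · rw [if_neg hx, antiVec, translateInd_of_not_mem (by rwa [one_smul])]
  rw [Finset.sum_congr rfl fun x _ => h1 x, Finset.sum_sub_distrib, ← Finset.mul_sum, Finset.sum_const,
    nsmul_eq_mul, mul_one, ← Finset.sum_filter, Finset.filter_filter, Finset.sum_const, nsmul_eq_mul, mul_one]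

end Pairing

/-! ### §1 Parallel non-zero shadows make the rank defect positive -/

section Parallel

variable [DecidableEq I] [Fintype I] [∀ i, Fintype (E i)] {Z : Type w} [MulAction G Z]

/-- **Two slots with parallel non-zero shadows on a common `G`-set are never additive.**  Let `F₀ : Z → E_{i₀} → ℚ`,
`F₁ : Z → E_{i₁} → ℚ` (`i₀ ≠ i₁`) be invariant kernels (`F_k (g • z) (g • x) = F_k z x`) whose shadows
`c_k(z) = Σ_x F_k z x · u_1(Φ_{i_k})(x)` satisfy `c₀ = q · c₁` and `c₀(z₀) ≠ 0`.  Then `dim U(Σ) < Σ_i dim U(Φ_i)`: the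
form `w ↦ Σ_x F₀ z₀ x · w(i₀,x) − q Σ_y F₁ z₀ y · w(i₁,y)` vanishes on every `u_g(Σ)` (value `c₀(g z₀) − q c₁(g z₀)`)
but not on `ext_{i₀} u_1(Φ_{i₀}) ∈ ⊕_i ext_i U(Φ_i)`. [cite: Gordon1999HodgeAVSurvey, §3 Theorem (proof), 7.5 and 9.4.3] -/
theorem finrank_antiSpan_sigmaType_lt_of_parallel (Φ : ∀ i, Set (E i)) {i₀ i₁ : I} (h01 : i₀ ≠ i₁)
    (F₀ : Z → E i₀ → ℚ) (F₁ : Z → E i₁ → ℚ) (hF₀ : ∀ (g : G) (z : Z) (x : E i₀), F₀ (g • z) (g • x) = F₀ z x)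
    (hF₁ : ∀ (g : G) (z : Z) (y : E i₁), F₁ (g • z) (g • y) = F₁ z y) (q : ℚ)
    (hpar : ∀ z : Z, ∑ x, F₀ z x * antiVec (Φ i₀) (1 : G) x = q * ∑ y, F₁ z y * antiVec (Φ i₁) (1 : G) y)
    {z₀ : Z} (hz₀ : ∑ x, F₀ z₀ x * antiVec (Φ i₀) (1 : G) x ≠ 0) :
    Module.finrank ℚ (antiSpan G (sigmaType Φ)) < ∑ i, Module.finrank ℚ (antiSpan G (Φ i)) := by
  -- the separating linear form
  let L₀ : ((Σ j, E j) → ℚ) →ₗ[ℚ] ℚ := ∑ x : E i₀, F₀ z₀ x • LinearMap.proj (⟨i₀, x⟩ : Σ j, E j)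
  let L₁ : ((Σ j, E j) → ℚ) →ₗ[ℚ] ℚ := ∑ y : E i₁, F₁ z₀ y • LinearMap.proj (⟨i₁, y⟩ : Σ j, E j)
  let lam : ((Σ j, E j) → ℚ) →ₗ[ℚ] ℚ := L₀ - q • L₁
  have hL₀ : ∀ w : (Σ j, E j) → ℚ, L₀ w = ∑ x, F₀ z₀ x * w ⟨i₀, x⟩ := fun w => by
    simp only [L₀, LinearMap.sum_apply, LinearMap.smul_apply, LinearMap.proj_apply, smul_eq_mul]
  have hL₁ : ∀ w : (Σ j, E j) → ℚ, L₁ w = ∑ y, F₁ z₀ y * w ⟨i₁, y⟩ := fun w => by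
    simp only [L₁, LinearMap.sum_apply, LinearMap.smul_apply, LinearMap.proj_apply, smul_eq_mul]
  have hlam : ∀ w : (Σ j, E j) → ℚ, lam w = (∑ x, F₀ z₀ x * w ⟨i₀, x⟩) - q * ∑ y, F₁ z₀ y * w ⟨i₁, y⟩ := fun w => by
    simp only [lam, LinearMap.sub_apply, LinearMap.smul_apply, hL₀, hL₁, smul_eq_mul]
  -- `λ` kills every simultaneous translate, hence `U(Σ)`
  have hker : antiSpan G (sigmaType Φ) ≤ LinearMap.ker lam := by
    refine Submodule.span_le.2 ?_
    rintro _ ⟨g, rfl⟩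
    rw [SetLike.mem_coe, LinearMap.mem_ker, hlam]
    simp only [antiVec_sigmaType]
    rw [sum_mul_antiVec_eq_apply_smul (Φ i₀) F₀ hF₀ g z₀, sum_mul_antiVec_eq_apply_smul (Φ i₁) F₁ hF₁ g z₀,
      hpar (g • z₀), sub_self]
  -- `ext_{i₀} u_1(Φ_{i₀})` lies in `⊕_i ext_i U(Φ_i)` but not in `ker λ`
  set W := LinearMap.range (sigmaLift ∘ₗ LinearMap.pi fun i => (antiSpan G (Φ i)).subtype ∘ₗ LinearMap.proj i)
    with hWdef
  have hvW : slotExt i₀ (antiVec (Φ i₀) (1 : G)) ∈ W := by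
    refine ⟨Pi.single i₀ ⟨antiVec (Φ i₀) (1 : G), Submodule.subset_span ⟨1, rfl⟩⟩, ?_⟩
    funext x
    obtain ⟨j, s⟩ := x
    change ((Pi.single (M := fun i => antiSpan G (Φ i)) i₀
      ⟨antiVec (Φ i₀) (1 : G), Submodule.subset_span ⟨1, rfl⟩⟩ j : antiSpan G (Φ j)) : E j → ℚ) s =
      slotExt i₀ (antiVec (Φ i₀) (1 : G)) ⟨j, s⟩
    by_cases hj : j = i₀
    · subst hj
      rw [Pi.single_eq_same, slotExt_apply_same]
    · rw [Pi.single_eq_of_ne hj, slotExt_apply_of_ne hj]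
      rfl
  have hvl : lam (slotExt i₀ (antiVec (Φ i₀) (1 : G))) ≠ 0 := by
    rw [hlam]
    simp only [slotExt_apply_same, slotExt_apply_of_ne h01.symm, mul_zero, Finset.sum_const_zero, mul_zero,
      sub_zero]
    exact hz₀
  -- strictness
  have hlt : antiSpan G (sigmaType Φ) < W := by
    refine lt_of_le_of_ne (antiSpan_sigmaType_le_range Φ) fun heq => hvl ?_
    have hv : slotExt i₀ (antiVec (Φ i₀) (1 : G)) ∈ antiSpan G (sigmaType Φ) := by rw [heq]; exact hvW
    exact LinearMap.mem_ker.1 (hker hv)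
  calc Module.finrank ℚ (antiSpan G (sigmaType Φ))
      < Module.finrank ℚ W := Submodule.finrank_lt_finrank_of_lt hlt
    _ ≤ Module.finrank ℚ (∀ i, antiSpan G (Φ i)) := LinearMap.finrank_range_le _
    _ = ∑ i, Module.finrank ℚ (antiSpan G (Φ i)) := Module.finrank_pi_fintype ℚ

variable [Nonempty I] [∀ i, Nonempty (E i)]

/-- **The rank is NOT additive** under parallel non-zero shadows: `rank(Σ) + |I| < Σ_i rank(Φ_i) + 1`
(`rank Hg(∏_i A_i) < Σ_i rank Hg(A_i)`). [cite: Gordon1999HodgeAVSurvey, §3 Theorem (proof), 7.5 and 9.4.3] -/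
theorem typeRank_sigmaType_add_card_lt_of_parallel {ρ : G} {Φ : ∀ i, Set (E i)} (h : ∀ i, IsCMTypeWith ρ (Φ i))
    {i₀ i₁ : I} (h01 : i₀ ≠ i₁) (F₀ : Z → E i₀ → ℚ) (F₁ : Z → E i₁ → ℚ)
    (hF₀ : ∀ (g : G) (z : Z) (x : E i₀), F₀ (g • z) (g • x) = F₀ z x)
    (hF₁ : ∀ (g : G) (z : Z) (y : E i₁), F₁ (g • z) (g • y) = F₁ z y) (q : ℚ)
    (hpar : ∀ z : Z, ∑ x, F₀ z x * antiVec (Φ i₀) (1 : G) x = q * ∑ y, F₁ z y * antiVec (Φ i₁) (1 : G) y)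
    {z₀ : Z} (hz₀ : ∑ x, F₀ z₀ x * antiVec (Φ i₀) (1 : G) x ≠ 0) :
    typeRank G (sigmaType Φ) + Fintype.card I < (∑ i, typeRank G (Φ i)) + 1 := by
  obtain ⟨j₀⟩ := ‹Nonempty I›
  haveI : Nonempty (Σ i, E i) := ⟨⟨j₀, Classical.arbitrary (E j₀)⟩⟩
  rw [(IsCMTypeWith.sigmaType h).typeRank_eq_finrank_antiSpan_add_one,
    Finset.sum_congr rfl fun i _ => (h i).typeRank_eq_finrank_antiSpan_add_one, Finset.sum_add_distrib,
    Finset.sum_const, Finset.card_univ, smul_eq_mul, mul_one]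
  have := finrank_antiSpan_sigmaType_lt_of_parallel Φ h01 F₀ F₁ hF₀ hF₁ q hpar hz₀
  omega

/-- **Parallel non-zero shadows force DEGENERACY of the family**: `rank(Σ) < |⊔_i E_i|/2 + 1`, whatever the members —
on abelian varieties: some `∏_i A_i^{k_i}` carries an exceptional Hodge class (Murty–Hazama), even if every `A_i` is
nondegenerate. [cite: Gordon1999HodgeAVSurvey, 7.5–7.7 and 9.4.3] -/
theorem typeRank_sigmaType_lt_of_parallel {ρ : G} {Φ : ∀ i, Set (E i)} (h : ∀ i, IsCMTypeWith ρ (Φ i))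
    {i₀ i₁ : I} (h01 : i₀ ≠ i₁) (F₀ : Z → E i₀ → ℚ) (F₁ : Z → E i₁ → ℚ)
    (hF₀ : ∀ (g : G) (z : Z) (x : E i₀), F₀ (g • z) (g • x) = F₀ z x)
    (hF₁ : ∀ (g : G) (z : Z) (y : E i₁), F₁ (g • z) (g • y) = F₁ z y) (q : ℚ)
    (hpar : ∀ z : Z, ∑ x, F₀ z x * antiVec (Φ i₀) (1 : G) x = q * ∑ y, F₁ z y * antiVec (Φ i₁) (1 : G) y)
    {z₀ : Z} (hz₀ : ∑ x, F₀ z₀ x * antiVec (Φ i₀) (1 : G) x ≠ 0) :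
    typeRank G (sigmaType Φ) < Fintype.card (Σ i, E i) / 2 + 1 := by
  have hlt := typeRank_sigmaType_add_card_lt_of_parallel h h01 F₀ F₁ hF₀ hF₁ q hpar hz₀
  have hle : ∀ i, typeRank G (Φ i) ≤ Fintype.card (E i) / 2 + 1 := fun i => (h i).typeRank_le
  have hsum : ∑ i, typeRank G (Φ i) ≤ ∑ i, (Fintype.card (E i) / 2 + 1) := Finset.sum_le_sum fun i _ => hle i
  rw [Finset.sum_add_distrib, Finset.sum_const, Finset.card_univ, smul_eq_mul, mul_one] at hsum
  rw [card_sigma_div_two h]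
  omega

/-- **No element of `⟨Stab Φ_{i₀} ∪ Stab Φ_{i₁}⟩` acts on the slot `i₀` as `ρ`** when the two-slot family has parallel
non-zero shadows (contrapositive of the stabiliser-closure criterion `CMTypeRankStabilizerClosure`).  For CM fields
(`Stab Φ = Aut(ℂ/K*)`, `K*` the reflex field): THE TWO REFLEX FIELDS DO NOT MEET IN A TOTALLY REAL FIELD.
[cite: Gordon1999HodgeAVSurvey, §3 Theorem (proof)] [cite: Deligne1982HodgeCycles, I Ex. 3.7 (c)] -/
theorem not_exists_smul_eq_rho_of_parallel {ρ : G} {Φ : ∀ i, Set (E i)} (h : ∀ i, IsCMTypeWith ρ (Φ i))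
    {i₀ i₁ : I} (hI : ∀ j, j = i₀ ∨ j = i₁) (h01 : i₀ ≠ i₁) (F₀ : Z → E i₀ → ℚ) (F₁ : Z → E i₁ → ℚ)
    (hF₀ : ∀ (g : G) (z : Z) (x : E i₀), F₀ (g • z) (g • x) = F₀ z x)
    (hF₁ : ∀ (g : G) (z : Z) (y : E i₁), F₁ (g • z) (g • y) = F₁ z y) (q : ℚ)
    (hpar : ∀ z : Z, ∑ x, F₀ z x * antiVec (Φ i₀) (1 : G) x = q * ∑ y, F₁ z y * antiVec (Φ i₁) (1 : G) y)
    {z₀ : Z} (hz₀ : ∑ x, F₀ z₀ x * antiVec (Φ i₀) (1 : G) x ≠ 0) :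
    ¬ ∃ g ∈ Subgroup.closure
        ({s : G | ∀ x : E i₀, s • x ∈ Φ i₀ ↔ x ∈ Φ i₀} ∪ {s : G | ∀ y : E i₁, s • y ∈ Φ i₁ ↔ y ∈ Φ i₁}),
      ∀ x : E i₀, g • x = ρ • x := fun hg => by
  have h1 := typeRank_sigmaType_add_card_eq_of_smul_eq_rho_of_mem_closure h hI h01 hg
  have h2 := typeRank_sigmaType_add_card_lt_of_parallel h h01 F₀ F₁ hF₀ hF₁ q hpar hz₀
  omega

end Parallel

/-! ### §2 The case that matters: shadows on a common equivariant quotient (signatures over a common subfield) -/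

section FibreSum

variable [DecidableEq I] [Fintype I] [∀ i, Fintype (E i)] {Z : Type w} [MulAction G Z]

/-- **Parallel non-zero signatures over a common quotient make the rank defect positive.**  Let `π₀ : E_{i₀} → Z`,
`π₁ : E_{i₁} → Z` be equivariant maps to one `G`-set (`i₀ ≠ i₁`) and let the fibre sums
`c_k(z) = Σ_{π_k x = z} u_1(Φ_{i_k})(x)` satisfy `c₀ = q · c₁`, `c₀(z₀) ≠ 0`.  Then `dim U(Σ) < Σ_i dim U(Φ_i)`.
[cite: Gordon1999HodgeAVSurvey, §3 Theorem (proof), 7.5 and 9.4.3] -/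
theorem finrank_antiSpan_sigmaType_lt_of_parallel_fibreSum (Φ : ∀ i, Set (E i)) {i₀ i₁ : I} (h01 : i₀ ≠ i₁)
    (π₀ : E i₀ → Z) (π₁ : E i₁ → Z) (hπ₀ : ∀ (g : G) (x : E i₀), π₀ (g • x) = g • π₀ x)
    (hπ₁ : ∀ (g : G) (y : E i₁), π₁ (g • y) = g • π₁ y) (q : ℚ)
    (hpar : ∀ z : Z, ∑ x ∈ Finset.univ.filter (fun x : E i₀ => π₀ x = z), antiVec (Φ i₀) (1 : G) x =
      q * ∑ y ∈ Finset.univ.filter (fun y : E i₁ => π₁ y = z), antiVec (Φ i₁) (1 : G) y)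
    {z₀ : Z} (hz₀ : ∑ x ∈ Finset.univ.filter (fun x : E i₀ => π₀ x = z₀), antiVec (Φ i₀) (1 : G) x ≠ 0) :
    Module.finrank ℚ (antiSpan G (sigmaType Φ)) < ∑ i, Module.finrank ℚ (antiSpan G (Φ i)) := by
  refine finrank_antiSpan_sigmaType_lt_of_parallel Φ h01 (fun z x => if π₀ x = z then (1 : ℚ) else 0)
    (fun z y => if π₁ y = z then (1 : ℚ) else 0) (fun g z x => fibreInd_smul hπ₀ g z x)
    (fun g z y => fibreInd_smul hπ₁ g z y) q (fun z => ?_) (z₀ := z₀) ?_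
  · rw [sum_fibreInd_mul_eq, sum_fibreInd_mul_eq]
    exact hpar z
  · rw [sum_fibreInd_mul_eq]
    exact hz₀

variable [Nonempty I] [∀ i, Nonempty (E i)]

/-- **Parallel non-zero signatures over a common quotient: the rank is not additive**
(`rank(Σ) + |I| < Σ_i rank(Φ_i) + 1`). [cite: Gordon1999HodgeAVSurvey, §3 Theorem (proof), 7.5 and 9.4.3] -/
theorem typeRank_sigmaType_add_card_lt_of_parallel_fibreSum {ρ : G} {Φ : ∀ i, Set (E i)}
    (h : ∀ i, IsCMTypeWith ρ (Φ i)) {i₀ i₁ : I} (h01 : i₀ ≠ i₁) (π₀ : E i₀ → Z) (π₁ : E i₁ → Z)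
    (hπ₀ : ∀ (g : G) (x : E i₀), π₀ (g • x) = g • π₀ x) (hπ₁ : ∀ (g : G) (y : E i₁), π₁ (g • y) = g • π₁ y)
    (q : ℚ)
    (hpar : ∀ z : Z, ∑ x ∈ Finset.univ.filter (fun x : E i₀ => π₀ x = z), antiVec (Φ i₀) (1 : G) x =
      q * ∑ y ∈ Finset.univ.filter (fun y : E i₁ => π₁ y = z), antiVec (Φ i₁) (1 : G) y)
    {z₀ : Z} (hz₀ : ∑ x ∈ Finset.univ.filter (fun x : E i₀ => π₀ x = z₀), antiVec (Φ i₀) (1 : G) x ≠ 0) :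
    typeRank G (sigmaType Φ) + Fintype.card I < (∑ i, typeRank G (Φ i)) + 1 := by
  obtain ⟨j₀⟩ := ‹Nonempty I›
  haveI : Nonempty (Σ i, E i) := ⟨⟨j₀, Classical.arbitrary (E j₀)⟩⟩
  rw [(IsCMTypeWith.sigmaType h).typeRank_eq_finrank_antiSpan_add_one,
    Finset.sum_congr rfl fun i _ => (h i).typeRank_eq_finrank_antiSpan_add_one, Finset.sum_add_distrib,
    Finset.sum_const, Finset.card_univ, smul_eq_mul, mul_one]
  have := finrank_antiSpan_sigmaType_lt_of_parallel_fibreSum Φ h01 π₀ π₁ hπ₀ hπ₁ q hpar hz₀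
  omega

/-- **Parallel non-zero signatures over a common quotient force DEGENERACY** (`rank(Σ) < |⊔ E_i|/2 + 1`).
[cite: Gordon1999HodgeAVSurvey, 7.5–7.7 and 9.4.3] -/
theorem typeRank_sigmaType_lt_of_parallel_fibreSum {ρ : G} {Φ : ∀ i, Set (E i)}
    (h : ∀ i, IsCMTypeWith ρ (Φ i)) {i₀ i₁ : I} (h01 : i₀ ≠ i₁) (π₀ : E i₀ → Z) (π₁ : E i₁ → Z)
    (hπ₀ : ∀ (g : G) (x : E i₀), π₀ (g • x) = g • π₀ x) (hπ₁ : ∀ (g : G) (y : E i₁), π₁ (g • y) = g • π₁ y)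
    (q : ℚ)
    (hpar : ∀ z : Z, ∑ x ∈ Finset.univ.filter (fun x : E i₀ => π₀ x = z), antiVec (Φ i₀) (1 : G) x =
      q * ∑ y ∈ Finset.univ.filter (fun y : E i₁ => π₁ y = z), antiVec (Φ i₁) (1 : G) y)
    {z₀ : Z} (hz₀ : ∑ x ∈ Finset.univ.filter (fun x : E i₀ => π₀ x = z₀), antiVec (Φ i₀) (1 : G) x ≠ 0) :
    typeRank G (sigmaType Φ) < Fintype.card (Σ i, E i) / 2 + 1 := by
  have hlt := typeRank_sigmaType_add_card_lt_of_parallel_fibreSum h h01 π₀ π₁ hπ₀ hπ₁ q hpar hz₀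
  have hle : ∀ i, typeRank G (Φ i) ≤ Fintype.card (E i) / 2 + 1 := fun i => (h i).typeRank_le
  have hsum : ∑ i, typeRank G (Φ i) ≤ ∑ i, (Fintype.card (E i) / 2 + 1) := Finset.sum_le_sum fun i _ => hle i
  rw [Finset.sum_add_distrib, Finset.sum_const, Finset.card_univ, smul_eq_mul, mul_one] at hsum
  rw [card_sigma_div_two h]
  omega

/-- **… and no element of `⟨Stab Φ_{i₀} ∪ Stab Φ_{i₁}⟩` acts on the slot `i₀` as `ρ`** (two-slot family): the reflex
fields do not meet in a totally real field. [cite: Gordon1999HodgeAVSurvey, §3 Theorem (proof)] -/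
theorem not_exists_smul_eq_rho_of_parallel_fibreSum {ρ : G} {Φ : ∀ i, Set (E i)}
    (h : ∀ i, IsCMTypeWith ρ (Φ i)) {i₀ i₁ : I} (hI : ∀ j, j = i₀ ∨ j = i₁) (h01 : i₀ ≠ i₁) (π₀ : E i₀ → Z)
    (π₁ : E i₁ → Z) (hπ₀ : ∀ (g : G) (x : E i₀), π₀ (g • x) = g • π₀ x)
    (hπ₁ : ∀ (g : G) (y : E i₁), π₁ (g • y) = g • π₁ y) (q : ℚ)
    (hpar : ∀ z : Z, ∑ x ∈ Finset.univ.filter (fun x : E i₀ => π₀ x = z), antiVec (Φ i₀) (1 : G) x =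
      q * ∑ y ∈ Finset.univ.filter (fun y : E i₁ => π₁ y = z), antiVec (Φ i₁) (1 : G) y)
    {z₀ : Z} (hz₀ : ∑ x ∈ Finset.univ.filter (fun x : E i₀ => π₀ x = z₀), antiVec (Φ i₀) (1 : G) x ≠ 0) :
    ¬ ∃ g ∈ Subgroup.closure
        ({s : G | ∀ x : E i₀, s • x ∈ Φ i₀ ↔ x ∈ Φ i₀} ∪ {s : G | ∀ y : E i₁, s • y ∈ Φ i₁ ↔ y ∈ Φ i₁}),
      ∀ x : E i₀, g • x = ρ • x := fun hg => by
  have h1 := typeRank_sigmaType_add_card_eq_of_smul_eq_rho_of_mem_closure h hI h01 hg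
  have h2 := typeRank_sigmaType_add_card_lt_of_parallel_fibreSum h h01 π₀ π₁ hπ₀ hπ₁ q hpar hz₀
  omega

end FibreSum

/-! ### §3 Yanai for pairs: two types over THE SAME subtype with unequal multiplicities are jointly degenerate -/

section Multiplicities

variable [Fintype I] [∀ i, Fintype (E i)] {Z : Type w} [MulAction G Z]

/-- **The signature of a type lying over `S₁` with multiplicities `(a, b)`**: `c(z) = a − b` for `z ∈ S₁` and `b − a`
for `z ∉ S₁` (over `z ∈ S₁` the fibre has `a` points in `Φ` and `a + b` points in all).
[cite: Gordon1999HodgeAVSurvey, 9.4.3] -/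
theorem fibreSum_antiVec_one_eq_of_multiplicities {X : Type*} [MulAction G X] [Fintype X] {π : X → Z} {ρ : G}
    {Φ : Set X} {S₁ : Set Z} {a b : ℕ} (hπ : ∀ (g : G) (x : X), π (g • x) = g • π x) (hΦ : IsCMTypeWith ρ Φ)
    (hS : IsCMTypeWith ρ S₁)
    (hmult : ∀ z : Z, (Finset.univ.filter fun x : X => π x = z ∧ x ∈ Φ).card = if z ∈ S₁ then a else b) (z : Z) :
    ∑ x ∈ Finset.univ.filter (fun x : X => π x = z), antiVec Φ (1 : G) x =
      if z ∈ S₁ then ((a : ℚ) - b) else ((b : ℚ) - a) := by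
  rw [fibreSum_antiVec_one_eq, card_fibre_eq hπ hΦ hS hmult z, hmult z]
  split_ifs <;> push_cast <;> ring

variable [DecidableEq I] [Nonempty I] [∀ i, Nonempty (E i)]

/-- **Yanai for pairs.**  Let `S₁ ⊆ Z` be a CM type for `ρ`, let `Φ_{i₀}` lie over `S₁` with multiplicities `(a₀, b₀)`
along an equivariant `π₀ : E_{i₀} → Z` and `Φ_{i₁}` over THE SAME `S₁` with multiplicities `(a₁, b₁)` along
`π₁ : E_{i₁} → Z` (`i₀ ≠ i₁`).  If `a₀ ≠ b₀` and `a₁ ≠ b₁` then `rank(Σ) + |I| < Σ_i rank(Φ_i) + 1`: the rank of the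
family is not additive.  (Yanai's one-type theorem, Gordon 9.4.3, concludes degeneracy of `Φ` from `a = b` or from a
degenerate `S₁`; here both members may be nondegenerate.) [cite: Gordon1999HodgeAVSurvey, 9.4.3 and 7.5] -/
theorem typeRank_sigmaType_add_card_lt_of_multiplicities {ρ : G} {Φ : ∀ i, Set (E i)}
    (h : ∀ i, IsCMTypeWith ρ (Φ i)) {i₀ i₁ : I} (h01 : i₀ ≠ i₁) {S₁ : Set Z} (hS : IsCMTypeWith ρ S₁)
    (π₀ : E i₀ → Z) (π₁ : E i₁ → Z) (hπ₀ : ∀ (g : G) (x : E i₀), π₀ (g • x) = g • π₀ x)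
    (hπ₁ : ∀ (g : G) (y : E i₁), π₁ (g • y) = g • π₁ y) {a₀ b₀ a₁ b₁ : ℕ}
    (hm₀ : ∀ z : Z, (Finset.univ.filter fun x : E i₀ => π₀ x = z ∧ x ∈ Φ i₀).card = if z ∈ S₁ then a₀ else b₀)
    (hm₁ : ∀ z : Z, (Finset.univ.filter fun y : E i₁ => π₁ y = z ∧ y ∈ Φ i₁).card = if z ∈ S₁ then a₁ else b₁)
    (h₀ : a₀ ≠ b₀) (h₁ : a₁ ≠ b₁) [Nonempty Z] :
    typeRank G (sigmaType Φ) + Fintype.card I < (∑ i, typeRank G (Φ i)) + 1 := by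
  have hq : ((a₁ : ℚ) - b₁) ≠ 0 := sub_ne_zero.2 (Nat.cast_injective.ne h₁)
  obtain ⟨z₀⟩ := ‹Nonempty Z›
  refine typeRank_sigmaType_add_card_lt_of_parallel_fibreSum h h01 π₀ π₁ hπ₀ hπ₁
    (((a₀ : ℚ) - b₀) / ((a₁ : ℚ) - b₁)) (fun z => ?_) (z₀ := z₀) ?_
  · rw [fibreSum_antiVec_one_eq_of_multiplicities hπ₀ (h i₀) hS hm₀ z,
      fibreSum_antiVec_one_eq_of_multiplicities hπ₁ (h i₁) hS hm₁ z]
    split_ifs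
    · field_simp
    · field_simp
      ring
  · rw [fibreSum_antiVec_one_eq_of_multiplicities hπ₀ (h i₀) hS hm₀ z₀]
    split_ifs
    · exact sub_ne_zero.2 (Nat.cast_injective.ne h₀)
    · exact sub_ne_zero.2 (Nat.cast_injective.ne (Ne.symm h₀))

/-- **Yanai for pairs, degeneracy form**: under the hypotheses of `typeRank_sigmaType_add_card_lt_of_multiplicities`
the family `Σ` is DEGENERATE (`rank(Σ) < |⊔ E_i|/2 + 1`), even if `Φ_{i₀}`, `Φ_{i₁}` and `S₁` are all nondegenerate.
[cite: Gordon1999HodgeAVSurvey, 9.4.3 and 7.5–7.7] -/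
theorem typeRank_sigmaType_lt_of_multiplicities {ρ : G} {Φ : ∀ i, Set (E i)}
    (h : ∀ i, IsCMTypeWith ρ (Φ i)) {i₀ i₁ : I} (h01 : i₀ ≠ i₁) {S₁ : Set Z} (hS : IsCMTypeWith ρ S₁)
    (π₀ : E i₀ → Z) (π₁ : E i₁ → Z) (hπ₀ : ∀ (g : G) (x : E i₀), π₀ (g • x) = g • π₀ x)
    (hπ₁ : ∀ (g : G) (y : E i₁), π₁ (g • y) = g • π₁ y) {a₀ b₀ a₁ b₁ : ℕ}
    (hm₀ : ∀ z : Z, (Finset.univ.filter fun x : E i₀ => π₀ x = z ∧ x ∈ Φ i₀).card = if z ∈ S₁ then a₀ else b₀)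
    (hm₁ : ∀ z : Z, (Finset.univ.filter fun y : E i₁ => π₁ y = z ∧ y ∈ Φ i₁).card = if z ∈ S₁ then a₁ else b₁)
    (h₀ : a₀ ≠ b₀) (h₁ : a₁ ≠ b₁) [Nonempty Z] :
    typeRank G (sigmaType Φ) < Fintype.card (Σ i, E i) / 2 + 1 := by
  have hlt := typeRank_sigmaType_add_card_lt_of_multiplicities h h01 hS π₀ π₁ hπ₀ hπ₁ hm₀ hm₁ h₀ h₁
  have hle : ∀ i, typeRank G (Φ i) ≤ Fintype.card (E i) / 2 + 1 := fun i => (h i).typeRank_le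
  have hsum : ∑ i, typeRank G (Φ i) ≤ ∑ i, (Fintype.card (E i) / 2 + 1) := Finset.sum_le_sum fun i _ => hle i
  rw [Finset.sum_add_distrib, Finset.sum_const, Finset.card_univ, smul_eq_mul, mul_one] at hsum
  rw [card_sigma_div_two h]
  omega

end Multiplicities

end Literature.NumberTheory.ComplexMultiplication.Shadow

end
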